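import Summits.Parity.GeneralizedHardyLittlewood.Theorems.PrimeLevelFamEdgeMomentsBeyondDiagonalFarLayersPairSum
import Summits.Parity.GeneralizedHardyLittlewood.Theorems.PrimeLevelFamEdgeMomentsBeyondDiagonalLayersBesselSeparation
import Mathlib.Analysis.PSeries
import HarnessLib

/-!
# Route `PrimeLevelFamEdge`, crux K_A `MomentsBeyondDiagonal` (stmt-Parity-20007), line «petersson_layers» v4:
# the AFE-WEIGHT TAIL of an order-`(i, j)` divisor-first layer sum, I: ONE TERM beyond the effective box (step A1 of `stub_farP`)

By `…LayersLayerFromOrderBound` the print band of `stub_farP` is a statement about the `Q`-free order-`(i,j)` divisor-first sums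
`I_{ij}(r) = Σ_{d₁,d₂,m₁',n₁',m₂',n₂'} [(d₁n₁'d₂n₂')^{−1/2} W_{ij}(q̂; d₁n₁', d₂n₂')] · [x_{d₁m₁'} x_{d₂m₂'} K_r-kernel(m₁'n₁', m₂'n₂')]`
(`n_i' ≤ q²/d_i`).  The bilinear (Pascadi / Fourier) analysis needs the AFE variables in the EFFECTIVE box `d₁n₁'·d₂n₂' ≤ Y`,
`Y ≈ q̂^{2+η}` (there the Bessel argument is `≪ 1` and the `v = n₁'n₂'` interval is `≤ qr`); this file disposes of the
complement with the decay `‖W_{ij}‖ ≪_A (q̂²/(n₁n₂))^A` (`TwoOrderAFE.norm_afeW_le_logsep`, every `A ≥ 0`) and TRIVIAL bounds only: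
* `norm_layerKernel_le_sqrt`: `‖K_r-kernel(a,b)‖ ≤ 4π² √(ab)/(qr)` (`|S(a,b;qr)| ≤ qr`, `|J₁(x)| ≤ x/2`);
* `weight_mul_sqrt_le_rpow`: `‖(N₁N₂)^{−1/2} W_{ij}‖ √(N₁N₂) ≤ K_A ((1+log q̂)(1+2log q))^{i+j} (q̂²/(N₁N₂))^A` on the AFE box;
* `norm_orderTerm_le_of_lt`: one term of `I_{ij}(r)` with `d₁n₁'d₂n₂' > Y` is
  `≤ E · (d₁d₂)^{−2} n₁'^{−2} n₂'^{−2}`, `E = 4π² K_A L B² (q̂²/Y)^{A−2} q̂⁴/(qr)` (`A ≥ 2`, `|x_m| ≤ B m^{−1/2}`);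
The summed tail (`≤ 16 ⌊M⌋² E`) and the split `I_{ij}(r) = main + tail` are in the sequel `…LayersWeightTail`.
Proof only (def-free helper); K_A NOT proved; nothing about Landau–Siegel zeros.
-/

noncomputable section

open scoped Real Nat
open Complex Finset Polynomial MeasureTheory
open Literature.NumberTheory.LFunctions
open Literature.Analysis.FunctionSpaces (besselJ abs_besselJ_one_le_half_mul)

namespace Summit.Parity.GeneralizedHardyLittlewood.Theorems.MomentsBeyondDiagonal.Layers

open Summit.Parity.GeneralizedHardyLittlewood.Theorems.PrimeLevelFamEdgeIdeaDeltas.PeterssonLayers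
open Summit.Parity.GeneralizedHardyLittlewood.Theorems.MomentsBeyondDiagonal.TwoOrderAFE (norm_afeW_le_logsep)

/-! ## §1. The trivial bound for the layer kernel -/

/-- **Trivial bound for the layer-`r` kernel** (`r ≥ 1`): `‖(2π/q) r⁻¹ S(a,b;qr) J₁(4π√(ab)/(qr))‖ ≤ 4π² √(ab)/(qr)`
(`|S(a,b;qr)| ≤ qr`, `|J₁(x)| ≤ x/2`). [cite: KowalskiMichel2000, §2.4.2 p. 312; DLMF, 10.14.1] -/
theorem norm_layerKernel_le_sqrt (q : ℕ) [NeZero q] {r : ℕ} (hr : r ≠ 0) (a b : ℕ) :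
    ‖layerKernel q r a b‖ ≤ 4 * π ^ 2 * Real.sqrt ((a : ℝ) * b) / ((q : ℝ) * r) := by
  haveI : NeZero (q * r) := ⟨mul_ne_zero (NeZero.ne q) hr⟩
  have hq0 : (0 : ℝ) < q := by exact_mod_cast Nat.pos_of_ne_zero (NeZero.ne q)
  have hr0 : (0 : ℝ) < r := by exact_mod_cast Nat.pos_of_ne_zero hr
  rw [layerKernel_of_ne_zero q hr a b, norm_mul, norm_mul, norm_mul, norm_inv, Complex.norm_natCast, Complex.norm_real,
    Real.norm_eq_abs]
  have h1 : ‖(2 * (π : ℂ) / (q : ℂ))‖ = 2 * π / (q : ℝ) := by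
    rw [norm_div, Complex.norm_natCast]
    congr 1
    rw [Complex.norm_mul, Complex.norm_real, Real.norm_eq_abs, abs_of_pos Real.pi_pos, Complex.norm_two]
  rw [h1]
  have hS : ‖kloostermanSum (q * r) (a : ZMod (q * r)) (b : ZMod (q * r))‖ ≤ (q : ℝ) * r := by
    have h := norm_kloostermanSum_le (q := q * r) (a : ZMod (q * r)) (b : ZMod (q * r))
    push_cast at h
    exact h
  have hx0 : 0 ≤ 4 * π * Real.sqrt ((a : ℝ) * b) / ((q : ℝ) * r) := by positivity
  have hJ := abs_besselJ_one_le_half_mul hx0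
  calc 2 * π / (q : ℝ) * ((r : ℝ)⁻¹ * ‖kloostermanSum (q * r) (a : ZMod (q * r)) (b : ZMod (q * r))‖ *
        |besselJ 1 (4 * π * Real.sqrt ((a : ℝ) * b) / ((q : ℝ) * r))|)
      ≤ 2 * π / (q : ℝ) * ((r : ℝ)⁻¹ * ((q : ℝ) * r) * (4 * π * Real.sqrt ((a : ℝ) * b) / ((q : ℝ) * r) / 2)) := by
        gcongr
    _ = 4 * π ^ 2 * Real.sqrt ((a : ℝ) * b) / ((q : ℝ) * r) := by
        field_simp

/-- The same with the square root split over a product pair: `‖K_r-kernel(m₁n₁, m₂n₂)‖ ≤ 4π² (√m₁√m₂)(√n₁√n₂)/(qr)`. [folklore] -/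
theorem norm_layerKernel_mul_le (q : ℕ) [NeZero q] {r : ℕ} (hr : r ≠ 0) (m₁ n₁ m₂ n₂ : ℕ) :
    ‖layerKernel q r (m₁ * n₁) (m₂ * n₂)‖ ≤
      4 * π ^ 2 * ((Real.sqrt m₁ * Real.sqrt m₂) * (Real.sqrt n₁ * Real.sqrt n₂)) / ((q : ℝ) * r) := by
  have h := norm_layerKernel_le_sqrt q hr (m₁ * n₁) (m₂ * n₂)
  have e : Real.sqrt (((m₁ * n₁ : ℕ) : ℝ) * ((m₂ * n₂ : ℕ) : ℝ)) =
      (Real.sqrt m₁ * Real.sqrt m₂) * (Real.sqrt n₁ * Real.sqrt n₂) := by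
    push_cast
    rw [Real.sqrt_mul (by positivity), Real.sqrt_mul (Nat.cast_nonneg _), Real.sqrt_mul (Nat.cast_nonneg _)]
    ring
  rw [e] at h
  exact h

/-! ## §2. The two-order AFE weight against `√(N₁N₂)`, any decay exponent `A` -/

/-- **The AFE weight in the box, against `√(N₁N₂)`, with decay exponent `A ≥ 0`**: there is `K ≥ 0` (depending on
`A, i, j`) with `‖(N₁N₂)^{−1/2} W_{ij}(q̂;N₁,N₂)‖ √(N₁N₂) ≤ K ((1+log q̂)(1+2 log q))^{i+j} (q̂²/(N₁N₂))^A` for `q ≥ 64` and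
`N₁, N₂` in the AFE box (`TwoOrderAFE.norm_afeW_le_logsep`). [cite: KowalskiMichelVanderKam2000, (22) p. 12 and (15) p. 9] -/
theorem weight_mul_sqrt_le_rpow (i j : ℕ) {A : ℝ} (hA : 0 ≤ A) :
    ∃ K : ℝ, 0 ≤ K ∧ ∀ {q : ℕ} [NeZero q], 64 ≤ q → ∀ {N₁ N₂ : ℕ}, N₁ ∈ afeBox q → N₂ ∈ afeBox q →
      ‖((((N₁ : ℝ) * N₂) ^ (-(1 / 2 : ℝ)) : ℝ) : ℂ) * afeW (KMV2000.qhat q) i j N₁ N₂‖ *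
          Real.sqrt ((N₁ : ℝ) * N₂) ≤
        K * ((1 + Real.log (KMV2000.qhat q)) * (1 + 2 * Real.log q)) ^ (i + j) *
          (KMV2000.qhat q ^ 2 / ((N₁ : ℝ) * N₂)) ^ A := by
  set K : ℝ := (∫ x in Set.Ioi (0 : ℝ), x ^ A * (Real.exp (-x) * (2 ^ i * (1 + |Real.log x| ^ i)))) *
    ∫ x in Set.Ioi (0 : ℝ), x ^ A * (Real.exp (-x) * (2 ^ j * (1 + |Real.log x| ^ j))) with hK
  have hK0 : 0 ≤ K :=
    mul_nonneg (setIntegral_nonneg measurableSet_Ioi fun x hx ↦ by have hx : (0 : ℝ) < x := hx; positivity)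
      (setIntegral_nonneg measurableSet_Ioi fun x hx ↦ by have hx : (0 : ℝ) < x := hx; positivity)
  refine ⟨K, hK0, fun {q} _ h64 {N₁ N₂} hN₁ hN₂ ↦ ?_⟩
  have hqh1 : 1 < KMV2000.qhat q := one_lt_qhat h64
  have hqh0 : 0 < KMV2000.qhat q := zero_lt_one.trans hqh1
  have h₁ : N₁ ≠ 0 := ne_zero_of_mem_afeBox hN₁
  have h₂ : N₂ ≠ 0 := ne_zero_of_mem_afeBox hN₂
  have hn₁0 : (0 : ℝ) < N₁ := by exact_mod_cast Nat.pos_of_ne_zero h₁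
  have hn₂0 : (0 : ℝ) < N₂ := by exact_mod_cast Nat.pos_of_ne_zero h₂
  have hN : (0 : ℝ) < (N₁ : ℝ) * N₂ := mul_pos hn₁0 hn₂0
  have hlogbox : ∀ {n : ℕ}, n ∈ afeBox q → 1 + Real.log (n : ℝ) ≤ 1 + 2 * Real.log q := by
    intro n hn
    have hn' := Finset.mem_Icc.mp hn
    have hn0 : (0 : ℝ) < n := by exact_mod_cast hn'.1
    have hle : (n : ℝ) ≤ ((q : ℝ)) ^ 2 := by exact_mod_cast hn'.2
    have := Real.log_le_log hn0 hle
    rw [Real.log_pow] at this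
    push_cast at this
    linarith
  have hW : ‖afeW (KMV2000.qhat q) i j N₁ N₂‖ ≤ K * (KMV2000.qhat q ^ 2 / ((N₁ : ℝ) * N₂)) ^ A *
      ((1 + Real.log (KMV2000.qhat q)) ^ (i + j) * (1 + Real.log N₁) ^ i * (1 + Real.log N₂) ^ j) := by
    rw [afeW_eq_kmv]
    exact norm_afeW_le_logsep hqh1.le i j hA h₁ h₂
  have hLq : 0 ≤ 1 + Real.log (KMV2000.qhat q) := by linarith [Real.log_nonneg hqh1.le]
  have hl₁ : 0 ≤ 1 + Real.log (N₁ : ℝ) := by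
    linarith [Real.log_nonneg (show (1 : ℝ) ≤ N₁ by exact_mod_cast Nat.one_le_iff_ne_zero.mpr h₁)]
  have hl₂ : 0 ≤ 1 + Real.log (N₂ : ℝ) := by
    linarith [Real.log_nonneg (show (1 : ℝ) ≤ N₂ by exact_mod_cast Nat.one_le_iff_ne_zero.mpr h₂)]
  have hlogs : (1 + Real.log (KMV2000.qhat q)) ^ (i + j) * (1 + Real.log N₁) ^ i * (1 + Real.log N₂) ^ j ≤
      ((1 + Real.log (KMV2000.qhat q)) * (1 + 2 * Real.log q)) ^ (i + j) := by
    rw [mul_pow, pow_add (1 + 2 * Real.log (q : ℝ))]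
    have g₁ : (1 + Real.log (N₁ : ℝ)) ^ i ≤ (1 + 2 * Real.log q) ^ i := pow_le_pow_left₀ hl₁ (hlogbox hN₁) i
    have g₂ : (1 + Real.log (N₂ : ℝ)) ^ j ≤ (1 + 2 * Real.log q) ^ j := pow_le_pow_left₀ hl₂ (hlogbox hN₂) j
    calc (1 + Real.log (KMV2000.qhat q)) ^ (i + j) * (1 + Real.log N₁) ^ i * (1 + Real.log N₂) ^ j
        = (1 + Real.log (KMV2000.qhat q)) ^ (i + j) * ((1 + Real.log N₁) ^ i * (1 + Real.log N₂) ^ j) := by ring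
      _ ≤ (1 + Real.log (KMV2000.qhat q)) ^ (i + j) * ((1 + 2 * Real.log q) ^ i * (1 + 2 * Real.log q) ^ j) :=
          mul_le_mul_of_nonneg_left (mul_le_mul g₁ g₂ (pow_nonneg hl₂ j) ((pow_nonneg hl₁ i).trans g₁))
            (pow_nonneg hLq _)
  have hnorm : ‖((((N₁ : ℝ) * N₂) ^ (-(1 / 2 : ℝ)) : ℝ) : ℂ) * afeW (KMV2000.qhat q) i j N₁ N₂‖ =
      ((N₁ : ℝ) * N₂) ^ (-(1 / 2 : ℝ)) * ‖afeW (KMV2000.qhat q) i j N₁ N₂‖ := by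
    rw [norm_mul, Complex.norm_real, Real.norm_eq_abs, abs_of_nonneg (Real.rpow_nonneg hN.le _)]
  -- `(N₁N₂)^{-1/2} · √(N₁N₂) = 1`
  have e2 : ((N₁ : ℝ) * N₂) ^ (-(1 / 2 : ℝ)) * Real.sqrt ((N₁ : ℝ) * N₂) = 1 := by
    rw [Real.sqrt_eq_rpow, ← Real.rpow_add hN]
    norm_num
  have hy : 0 ≤ (KMV2000.qhat q ^ 2 / ((N₁ : ℝ) * N₂)) ^ A := Real.rpow_nonneg (by positivity) _
  rw [hnorm]
  calc ((N₁ : ℝ) * N₂) ^ (-(1 / 2 : ℝ)) * ‖afeW (KMV2000.qhat q) i j N₁ N₂‖ * Real.sqrt ((N₁ : ℝ) * N₂)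
      = (((N₁ : ℝ) * N₂) ^ (-(1 / 2 : ℝ)) * Real.sqrt ((N₁ : ℝ) * N₂)) * ‖afeW (KMV2000.qhat q) i j N₁ N₂‖ := by ring
    _ = ‖afeW (KMV2000.qhat q) i j N₁ N₂‖ := by rw [e2, one_mul]
    _ ≤ K * (KMV2000.qhat q ^ 2 / ((N₁ : ℝ) * N₂)) ^ A *
          ((1 + Real.log (KMV2000.qhat q)) ^ (i + j) * (1 + Real.log N₁) ^ i * (1 + Real.log N₂) ^ j) := hW
    _ ≤ K * (KMV2000.qhat q ^ 2 / ((N₁ : ℝ) * N₂)) ^ A *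
          ((1 + Real.log (KMV2000.qhat q)) * (1 + 2 * Real.log q)) ^ (i + j) :=
        mul_le_mul_of_nonneg_left hlogs (mul_nonneg hK0 hy)
    _ = _ := by ring

/-! ## §3. Small real-number steps -/

/-- For `0 < Y ≤ X` and `A ≥ 2`: `(c/X)^A ≤ (c/Y)^{A−2} · (c² · (X²)⁻¹)` (`c ≥ 0`). [folklore] -/
theorem div_rpow_le_of_le {c X Y A : ℝ} (hc : 0 ≤ c) (hY : 0 < Y) (hXY : Y ≤ X) (hA : 2 ≤ A) :
    (c / X) ^ A ≤ (c / Y) ^ (A - 2) * (c ^ 2 * (X ^ 2)⁻¹) := by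
  have hX : 0 < X := lt_of_lt_of_le hY hXY
  have hcX : 0 ≤ c / X := div_nonneg hc hX.le
  have hsplit : (c / X) ^ A = (c / X) ^ (A - 2) * (c / X) ^ (2 : ℝ) := by
    rw [← Real.rpow_add' hcX (by linarith)]
    ring_nf
  rw [hsplit, Real.rpow_two, div_pow]
  refine mul_le_mul_of_nonneg_right ?_ (by positivity)
  exact Real.rpow_le_rpow hcX (div_le_div_of_nonneg_left hc hY hXY) (by linarith)

/-- `(dm)^{−1/2} · √m ≤ 1` for `d ≥ 1`, `m ≥ 1`. [folklore] -/
theorem rpow_neg_half_mul_sqrt_le_one {d m : ℕ} (hd : 1 ≤ d) (hm : 1 ≤ m) :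
    (((d * m : ℕ)) : ℝ) ^ (-(1 / 2 : ℝ)) * Real.sqrt m ≤ 1 := by
  have hm0 : (0 : ℝ) < m := by exact_mod_cast hm
  have hdm : (m : ℝ) ≤ ((d * m : ℕ) : ℝ) := by
    have : m ≤ d * m := Nat.le_mul_of_pos_left m hd
    exact_mod_cast this
  have h1 : (((d * m : ℕ)) : ℝ) ^ (-(1 / 2 : ℝ)) ≤ (m : ℝ) ^ (-(1 / 2 : ℝ)) :=
    Real.rpow_le_rpow_of_nonpos hm0 hdm (by norm_num)
  calc (((d * m : ℕ)) : ℝ) ^ (-(1 / 2 : ℝ)) * Real.sqrt m ≤ (m : ℝ) ^ (-(1 / 2 : ℝ)) * Real.sqrt m :=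
        mul_le_mul_of_nonneg_right h1 (Real.sqrt_nonneg _)
    _ = 1 := by
        rw [Real.sqrt_eq_rpow, ← Real.rpow_add hm0]
        norm_num

/-- `Σ_{n ≤ X} 1/n² ≤ 2` (Mathlib's `sum_Ioo_inv_sq_le`). [folklore] -/
theorem sum_Icc_inv_sq_le_two (X : ℕ) : ∑ n ∈ Icc 1 X, (((n : ℝ)) ^ 2)⁻¹ ≤ 2 := by
  have h := sum_Ioo_inv_sq_le (α := ℝ) 0 (X + 1)
  have hI : Icc 1 X = Ioo 0 (X + 1) := by
    ext n
    simp only [mem_Icc, mem_Ioo]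
    omega
  rw [hI]
  simpa using h

/-! ## §4. One term of the tail -/

/-- For `d ≥ 1` and `m ∈ [1, M₀/d]`: `dm ∈ [1, M₀]`. [folklore] -/
theorem mul_mem_Icc_of_mem_div {d m M₀ : ℕ} (hd : 1 ≤ d) (hm : m ∈ Icc 1 (M₀ / d)) : d * m ∈ Icc 1 M₀ := by
  rw [mem_Icc] at hm ⊢
  refine ⟨le_trans hm.1 (Nat.le_mul_of_pos_left m hd), ?_⟩
  exact (Nat.mul_le_mul_left d hm.2).trans (Nat.mul_div_le M₀ d)

/-- **One term of `I_{ij}(r)` beyond the effective box.** For `q ≥ 64`, `Δ' > 0` (`M = q̂^{Δ'}`), `|P| ≤ B` on `[0,1]`,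
`r ≥ 1`, `A ≥ 2`, a weight constant `K` as in `weight_mul_sqrt_le_rpow`, `Y ≥ 1`, indices in their ranges and
`d₁n₁'·d₂n₂' > Y`: the term is `≤ E · (d₁d₂)^{−2} n₁'^{−2} n₂'^{−2}`,
`E = 4π² K L B² (q̂²/Y)^{A−2} q̂⁴/(qr)`, `L = ((1+log q̂)(1+2 log q))^{i+j}`. [folklore] -/
theorem norm_orderTerm_le_of_lt {q : ℕ} [NeZero q] (h64 : 64 ≤ q) {P : ℝ[X]} {B : ℝ}
    (hB : ∀ t ∈ Set.Icc (0 : ℝ) 1, |P.eval t| ≤ B) {Δ' : ℝ} (hΔ' : 0 < Δ') (i j : ℕ) {A K : ℝ} (hA : 2 ≤ A)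
    (hK0 : 0 ≤ K)
    (hK : ∀ {N₁ N₂ : ℕ}, N₁ ∈ afeBox q → N₂ ∈ afeBox q →
      ‖((((N₁ : ℝ) * N₂) ^ (-(1 / 2 : ℝ)) : ℝ) : ℂ) * afeW (KMV2000.qhat q) i j N₁ N₂‖ *
          Real.sqrt ((N₁ : ℝ) * N₂) ≤
        K * ((1 + Real.log (KMV2000.qhat q)) * (1 + 2 * Real.log q)) ^ (i + j) *
          (KMV2000.qhat q ^ 2 / ((N₁ : ℝ) * N₂)) ^ A)
    {r : ℕ} (hr : r ≠ 0) {Y : ℕ} (hY : 1 ≤ Y)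
    {d₁ d₂ m₁ n₁ m₂ n₂ : ℕ} (hd₁ : d₁ ∈ Icc 1 ⌊KMV2000.qhat q ^ Δ'⌋₊) (hd₂ : d₂ ∈ Icc 1 ⌊KMV2000.qhat q ^ Δ'⌋₊)
    (hm₁ : m₁ ∈ Icc 1 (⌊KMV2000.qhat q ^ Δ'⌋₊ / d₁)) (hn₁ : n₁ ∈ Icc 1 (q ^ 2 / d₁))
    (hm₂ : m₂ ∈ Icc 1 (⌊KMV2000.qhat q ^ Δ'⌋₊ / d₂)) (hn₂ : n₂ ∈ Icc 1 (q ^ 2 / d₂))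
    (hlt : Y < d₁ * n₁ * (d₂ * n₂)) :
    ‖((((((d₁ * n₁ : ℕ) : ℝ) * ((d₂ * n₂ : ℕ) : ℝ)) ^ (-(1 / 2 : ℝ)) : ℝ) : ℂ) *
          afeW (KMV2000.qhat q) i j (d₁ * n₁) (d₂ * n₂)) *
        ((KMV2000.mollifierCoeff P (KMV2000.qhat q ^ Δ') (d₁ * m₁) : ℂ) *
          (KMV2000.mollifierCoeff P (KMV2000.qhat q ^ Δ') (d₂ * m₂) : ℂ) *
          layerKernel q r (m₁ * n₁) (m₂ * n₂))‖ ≤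
      (4 * π ^ 2 * K * ((1 + Real.log (KMV2000.qhat q)) * (1 + 2 * Real.log q)) ^ (i + j) * B ^ 2 *
          (KMV2000.qhat q ^ 2 / (Y : ℝ)) ^ (A - 2) * KMV2000.qhat q ^ 4 / ((q : ℝ) * r)) *
        (((((d₁ : ℝ) * d₂) ^ 2)⁻¹) * (((n₁ : ℝ) ^ 2)⁻¹) * (((n₂ : ℝ) ^ 2)⁻¹)) := by
  have hqh1 : 1 < KMV2000.qhat q := one_lt_qhat h64
  have hqh0 : 0 < KMV2000.qhat q := zero_lt_one.trans hqh1
  have hM1 : 1 < KMV2000.qhat q ^ Δ' := Real.one_lt_rpow hqh1 hΔ'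
  have hq0 : (0 : ℝ) < q := by exact_mod_cast Nat.pos_of_ne_zero (NeZero.ne q)
  have hr0 : (0 : ℝ) < r := by exact_mod_cast Nat.pos_of_ne_zero hr
  have hB0 : 0 ≤ B := le_trans (abs_nonneg _) (hB 0 (by simp))
  set L : ℝ := ((1 + Real.log (KMV2000.qhat q)) * (1 + 2 * Real.log q)) ^ (i + j) with hL
  have hL0 : 0 ≤ L := by
    rw [hL]
    refine pow_nonneg (mul_nonneg ?_ ?_) _
    · linarith [Real.log_nonneg hqh1.le]
    · have : (1 : ℝ) ≤ q := by exact_mod_cast (le_trans (by norm_num) h64 : 1 ≤ q)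
      linarith [Real.log_nonneg this]
  -- ranges
  have hd₁1 : 1 ≤ d₁ := (mem_Icc.mp hd₁).1
  have hd₂1 : 1 ≤ d₂ := (mem_Icc.mp hd₂).1
  have hm₁1 : 1 ≤ m₁ := (mem_Icc.mp hm₁).1
  have hm₂1 : 1 ≤ m₂ := (mem_Icc.mp hm₂).1
  have hn₁1 : 1 ≤ n₁ := (mem_Icc.mp hn₁).1
  have hn₂1 : 1 ≤ n₂ := (mem_Icc.mp hn₂).1
  have hN₁ : d₁ * n₁ ∈ afeBox q := by unfold afeBox; exact mul_mem_Icc_of_mem_div hd₁1 hn₁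
  have hN₂ : d₂ * n₂ ∈ afeBox q := by unfold afeBox; exact mul_mem_Icc_of_mem_div hd₂1 hn₂
  have hM₁ : d₁ * m₁ ∈ Icc 1 ⌊KMV2000.qhat q ^ Δ'⌋₊ := mul_mem_Icc_of_mem_div hd₁1 hm₁
  have hM₂ : d₂ * m₂ ∈ Icc 1 ⌊KMV2000.qhat q ^ Δ'⌋₊ := mul_mem_Icc_of_mem_div hd₂1 hm₂
  have hd₁0 : (0 : ℝ) < d₁ := by exact_mod_cast hd₁1
  have hd₂0 : (0 : ℝ) < d₂ := by exact_mod_cast hd₂1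
  have hn₁0 : (0 : ℝ) < n₁ := by exact_mod_cast hn₁1
  have hn₂0 : (0 : ℝ) < n₂ := by exact_mod_cast hn₂1
  -- the three trivial bounds
  have hx₁ := norm_mollifierCoeff_le hB hM1 hM₁
  have hx₂ := norm_mollifierCoeff_le hB hM1 hM₂
  have hκ := norm_layerKernel_mul_le q hr m₁ n₁ m₂ n₂
  have hw := hK hN₁ hN₂
  -- the weight against `√n₁ √n₂ ≤ √(N₁ N₂)`
  have hXeq : ((d₁ * n₁ : ℕ) : ℝ) * ((d₂ * n₂ : ℕ) : ℝ) = ((d₁ : ℝ) * d₂) * ((n₁ : ℝ) * n₂) := by push_cast; ring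
  have hX0 : 0 < ((d₁ * n₁ : ℕ) : ℝ) * ((d₂ * n₂ : ℕ) : ℝ) := by rw [hXeq]; positivity
  have hsqrt_le : Real.sqrt n₁ * Real.sqrt n₂ ≤ Real.sqrt (((d₁ * n₁ : ℕ) : ℝ) * ((d₂ * n₂ : ℕ) : ℝ)) := by
    rw [← Real.sqrt_mul (Nat.cast_nonneg n₁)]
    refine Real.sqrt_le_sqrt ?_
    rw [hXeq]
    have h1 : (1 : ℝ) ≤ (d₁ : ℝ) * d₂ := by
      have : (1 : ℝ) ≤ d₁ := by exact_mod_cast hd₁1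
      have : (1 : ℝ) ≤ d₂ := by exact_mod_cast hd₂1
      nlinarith
    nlinarith [mul_pos hn₁0 hn₂0]
  set w : ℝ := ‖((((((d₁ * n₁ : ℕ) : ℝ) * ((d₂ * n₂ : ℕ) : ℝ)) ^ (-(1 / 2 : ℝ)) : ℝ) : ℂ) *
      afeW (KMV2000.qhat q) i j (d₁ * n₁) (d₂ * n₂))‖ with hwdef
  have hw0 : 0 ≤ w := norm_nonneg _
  have hwn : w * (Real.sqrt n₁ * Real.sqrt n₂) ≤
      K * L * (KMV2000.qhat q ^ 2 / (((d₁ * n₁ : ℕ) : ℝ) * ((d₂ * n₂ : ℕ) : ℝ))) ^ A :=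
    (mul_le_mul_of_nonneg_left hsqrt_le hw0).trans hw
  -- the mollifier coefficients against `√m`
  have hy₁ : ((d₁ * m₁ : ℕ) : ℝ) ^ (-(1 / 2 : ℝ)) * Real.sqrt m₁ ≤ 1 := rpow_neg_half_mul_sqrt_le_one hd₁1 hm₁1
  have hy₂ : ((d₂ * m₂ : ℕ) : ℝ) ^ (-(1 / 2 : ℝ)) * Real.sqrt m₂ ≤ 1 := rpow_neg_half_mul_sqrt_le_one hd₂1 hm₂1
  have hz₁ : 0 ≤ ((d₁ * m₁ : ℕ) : ℝ) ^ (-(1 / 2 : ℝ)) := Real.rpow_nonneg (Nat.cast_nonneg _) _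
  have hz₂ : 0 ≤ ((d₂ * m₂ : ℕ) : ℝ) ^ (-(1 / 2 : ℝ)) := Real.rpow_nonneg (Nat.cast_nonneg _) _
  -- the decay step
  have hYX : (Y : ℝ) ≤ ((d₁ * n₁ : ℕ) : ℝ) * ((d₂ * n₂ : ℕ) : ℝ) := by exact_mod_cast hlt.le
  have hY0 : (0 : ℝ) < Y := by exact_mod_cast hY
  have hdec : (KMV2000.qhat q ^ 2 / (((d₁ * n₁ : ℕ) : ℝ) * ((d₂ * n₂ : ℕ) : ℝ))) ^ A ≤
      (KMV2000.qhat q ^ 2 / (Y : ℝ)) ^ (A - 2) *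
        ((KMV2000.qhat q ^ 2) ^ 2 * ((((d₁ * n₁ : ℕ) : ℝ) * ((d₂ * n₂ : ℕ) : ℝ)) ^ 2)⁻¹) :=
    div_rpow_le_of_le (pow_nonneg hqh0.le 2) hY0 hYX hA
  have hdec0 : 0 ≤ (KMV2000.qhat q ^ 2 / (Y : ℝ)) ^ (A - 2) := Real.rpow_nonneg (by positivity) _
  -- assemble
  have hsplit : ‖((((((d₁ * n₁ : ℕ) : ℝ) * ((d₂ * n₂ : ℕ) : ℝ)) ^ (-(1 / 2 : ℝ)) : ℝ) : ℂ) *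
          afeW (KMV2000.qhat q) i j (d₁ * n₁) (d₂ * n₂)) *
        ((KMV2000.mollifierCoeff P (KMV2000.qhat q ^ Δ') (d₁ * m₁) : ℂ) *
          (KMV2000.mollifierCoeff P (KMV2000.qhat q ^ Δ') (d₂ * m₂) : ℂ) *
          layerKernel q r (m₁ * n₁) (m₂ * n₂))‖ =
      w * (‖(KMV2000.mollifierCoeff P (KMV2000.qhat q ^ Δ') (d₁ * m₁) : ℂ)‖ *
          ‖(KMV2000.mollifierCoeff P (KMV2000.qhat q ^ Δ') (d₂ * m₂) : ℂ)‖ *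
          ‖layerKernel q r (m₁ * n₁) (m₂ * n₂)‖) := by
    rw [hwdef]
    simp only [norm_mul]
  rw [hsplit]
  calc w * (‖(KMV2000.mollifierCoeff P (KMV2000.qhat q ^ Δ') (d₁ * m₁) : ℂ)‖ *
          ‖(KMV2000.mollifierCoeff P (KMV2000.qhat q ^ Δ') (d₂ * m₂) : ℂ)‖ *
          ‖layerKernel q r (m₁ * n₁) (m₂ * n₂)‖)
      ≤ w * ((B * ((d₁ * m₁ : ℕ) : ℝ) ^ (-(1 / 2 : ℝ))) * (B * ((d₂ * m₂ : ℕ) : ℝ) ^ (-(1 / 2 : ℝ))) *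
          (4 * π ^ 2 * ((Real.sqrt m₁ * Real.sqrt m₂) * (Real.sqrt n₁ * Real.sqrt n₂)) / ((q : ℝ) * r))) := by
        refine mul_le_mul_of_nonneg_left ?_ hw0
        exact mul_le_mul (mul_le_mul hx₁ hx₂ (norm_nonneg _) (by positivity)) hκ (norm_nonneg _)
          (by positivity)
    _ = (4 * π ^ 2 / ((q : ℝ) * r)) * B ^ 2 *
          ((((d₁ * m₁ : ℕ) : ℝ) ^ (-(1 / 2 : ℝ)) * Real.sqrt m₁) *
            (((d₂ * m₂ : ℕ) : ℝ) ^ (-(1 / 2 : ℝ)) * Real.sqrt m₂)) *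
          (w * (Real.sqrt n₁ * Real.sqrt n₂)) := by ring
    _ ≤ (4 * π ^ 2 / ((q : ℝ) * r)) * B ^ 2 * (1 * 1) *
          (K * L * (KMV2000.qhat q ^ 2 / (((d₁ * n₁ : ℕ) : ℝ) * ((d₂ * n₂ : ℕ) : ℝ))) ^ A) := by
        refine mul_le_mul (mul_le_mul_of_nonneg_left (mul_le_mul hy₁ hy₂ (by positivity) zero_le_one)
          (by positivity)) hwn (by positivity) (by positivity)
    _ ≤ (4 * π ^ 2 / ((q : ℝ) * r)) * B ^ 2 * (1 * 1) *
          (K * L * ((KMV2000.qhat q ^ 2 / (Y : ℝ)) ^ (A - 2) *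
            ((KMV2000.qhat q ^ 2) ^ 2 * ((((d₁ * n₁ : ℕ) : ℝ) * ((d₂ * n₂ : ℕ) : ℝ)) ^ 2)⁻¹))) := by
        refine mul_le_mul_of_nonneg_left (mul_le_mul_of_nonneg_left hdec (mul_nonneg hK0 hL0)) (by positivity)
    _ = _ := by
        rw [hXeq]
        ring

end Summit.Parity.GeneralizedHardyLittlewood.Theorems.MomentsBeyondDiagonal.Layers

end
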